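import Summits.QuantumFields.BalabanUV.Beta.D1BFx.KGhostTerm
import Summits.QuantumFields.BalabanUV.Beta.D1BFx.GhostHalfCovariant

/-!
# `BalabanUV.Beta.D1BFx.KGhostTermWords` — road «BF-x» for binder row D1, slot (K), brick **TB5-2c-A′: THE GHOST TERM OF ROUTE T UNDER (R2) FOR
# ARBITRARY (SUPERPOSED, CHAIN-RULE) WEIGHT JETS** (ruling ρ-g7-1 (1), generalising `KGhostTerm` p244170 from single background bonds `b, b′` to
# arbitrary site words).  WHY: the literal's jets are CHAIN-RULE jets (`OneStepKernelFamily.vertexOfK`: superpositions over fine bonds weighted by the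
# `ℋ`-column, plus the second response), so the weight jets fed to TB5-1 are the TOTAL jets of `T(U) = N̂ᵀL̂_U D̂_U*`, `A(U) = 2•(N̂ᵀL̂_U²N̂)⁻¹` along a
# two-parameter background family: `Tₛ = (N̂ᵀMₛ).submatrix id e₁`, `Gₛ = N̂ᵀYₛN̂`, `Aₛ = −2•G₀⁻¹GₛG₀⁻¹`, `Aₛₜ` by the inverse-jet rule, for ARBITRARY site ×
# bond words `Mₛ Mₜ Mₛₜ` and site words `Yₛ Yₜ Yₛₜ`.  RESULT: TB5-1's FP-Gram functional is `2·hessT (Ĉ; MₛD̂, MₜD̂, MₛₜD̂) − hessT (Ĉ; Yₛ, Yₜ, Yₛₜ)`,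
# `Ĉ = N̂(N̂ᵀL̂L̂N̂)⁻¹N̂ᵀ` — NO relation between the `M`-words and the `Y`-words is used; `KGhostTerm.hessT_ghostTerm_Nhat` is the instance
# `Mₛ := Mjet₁ b`, `Yₛ := (L̂²)ₛ`

HONEST FRAMING (cell contract, verbatim): «discharging `BetaPertH` makes Bałaban's UV stability UNCONDITIONAL — a real constructive-QFT
result; it is NOT the continuum limit and NOT the Clay problem.»  HONEST DEPENDENCY (verbatim): «continuum YM on T⁴ ⇐ BetaPertH ∧ nine
spine estimates (0/9 proved); BetaPertH ⇐ (D1) ∧ (D4) ∧ CAP+tail; G-an2-4 gates asym, D1 and NE2/3/4.»  THIS MODULE DISCHARGES NOTHING of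
D1 / BetaPertH: [folklore] finite matrix algebra BY NAME over `KGhostTerm` (`hessT_compress`, `Tjet_mul_basis`, `Mjet₀_mul_Dhat`), leaf-03-g9's
`TorusCoframeJets` (`hessT_inv_jets`, `hessT_smul`, `Tjet₀_eq_coframe`, `isUnit_det_Gjet₀`), gan24-leaf-03-g44's `GramWeightJetsMixed.hessT_gram_split_jets` and
this lineage's `KTransferTorus`.  No `def`, no `def … : Prop`, nothing cited, 0 sorry.  The jets are FREE here; which words are the literal's is TB4 (T1)
∕ «TB4-W» 3b (for the literal of record JsB12Sym per R-D1-g25-1: the S_D-symmetrised tables, when typed).  NOT summit progress; NOT BetaPertH,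
NOT continuum, NOT Clay.

ABSOLUTE RULE (cell, verbatim): «No internally-minted statement may enter as a cited fact. Every hypothesis is either kernel-proved in this
package or a verbatim quotation of a PUBLISHED theorem with page reference. The manuscript(s) under audit are NOT citable for their own
disputed steps — they are the thing under adjudication; programme-internal (2001/route/tribunal) claims are never citable.»

CONTENT (all [folklore]; `s = (m+1)·p`, `N̂ = Nhat r (m+1) p`, `L̂ = Lhat s`, `D̂ = Dhat 4 s`, `G₀ = N̂ᵀL̂L̂N̂`, `Ĉ = N̂G₀⁻¹N̂ᵀ`).
* §1 (imported) `GhostHalfCovariant.hessT_inv_words'`: `hessT (2•G₀⁻¹)⁻¹ Aₛ Aₜ Aₛₜ = −hessT G₀⁻¹ Gₛ Gₜ Gₛₜ` for the inverse-jet words of ANY `Gₛ Gₜ Gₛₜ` (`IsUnit G₀.det`); v2 of this file drops its local copy (gate `dedup.landed`, p245710).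
* §2 **`hessT_ghostTerm_words`** — the displayed evaluation for arbitrary words.
* §3 **`hessT_transfer_road_words`** — TB5-1 with §2 substituted (every functional «one leg × words»).
Unit `b2b-balaban-beta-d1-p2` (road owner, gen 7).
-/

noncomputable section

namespace Summit.QuantumFields.BalabanUV.Beta.D1BFx.KGhostTermWords

open Matrix
open scoped BigOperators
open Literature.MathematicalPhysics.QuantumFieldTheory.Balaban1983to89
open Literature.MathematicalPhysics.QuantumFieldTheory.Balaban1983to89.Beta
open Literature.MathematicalPhysics.QuantumFieldTheory.Balaban1983to89.Beta.Composition (kkt)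
open AffineAveraging (box toSite)
open Summit.QuantumFields.BalabanUV.Beta.TameKernelCalculus (Spr)
open Summit.QuantumFields.BalabanUV.Beta.D1BFx.SortedKernels (blocksHat)
open Summit.QuantumFields.BalabanUV.Beta.D1BFx.SortedPack (sortK)
open Summit.QuantumFields.BalabanUV.Beta.D1BFx.SortedEmbedding (e₁)
open Summit.QuantumFields.BalabanUV.Beta.D1BFx.TorusCombKKT (I J CombRows tauT Khat Qhat)
open Summit.QuantumFields.BalabanUV.Beta.D1BFx.TorusGaugeBasis (What0)
open Summit.QuantumFields.BalabanUV.Beta.D1BFx.PeriodisedProjector (Lhat Shat)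
open Summit.QuantumFields.BalabanUV.Beta.D1BFx.TorusHodgeWeight (Dhat DhatS)
open Summit.QuantumFields.BalabanUV.Beta.D1BFx.TorusZerothJunction (det_coframe_mul_basis_road_ne_zero det_weightA_road_ne_zero)
open Summit.QuantumFields.BalabanUV.Beta.D1BFx.MixedVarPackedHess (hessT)
open Summit.QuantumFields.BalabanUV.Beta.D1BFx.GramWeightJets (gram₀ gram₁)
open Summit.QuantumFields.BalabanUV.Beta.D1BFx.GramWeightJetsMixed (gramMix hessT_gram_split_jets)
open Summit.QuantumFields.BalabanUV.Beta.D1BFx.RWeightedLegPack (NlegRoad)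
open Summit.QuantumFields.BalabanUV.Beta.D1BFx.TorusGaugeBasisMatrix (Nhat)
open Summit.QuantumFields.BalabanUV.Beta.D1BFx.TorusGaugeBasisKernel (Nhat_range Nhat_injective What0_eq_DhatS_mul_Nhat)
open Summit.QuantumFields.BalabanUV.Beta.D1BFx.KTransferTorus (gram₁_zero_basis gramMix_zero_basis gram₀_eq hessT_transfer_road_Nhat)
open Summit.QuantumFields.BalabanUV.Beta.D1BFx.TorusCoframeJets (Mjet₀ Tjet₀ Gjet₀ hessT_smul hessT_inv_jets Tjet₀_eq_coframe isUnit_det_Gjet₀)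
open Summit.QuantumFields.BalabanUV.Beta.D1BFx.KGhostTerm (hessT_compress Tjet_mul_basis Mjet₀_mul_Dhat)
open Summit.QuantumFields.BalabanUV.Beta.D1BFx.GhostHalfCovariant (hessT_inv_words')

/-! ## §2 The ghost term of TB5-1 for arbitrary words -/

section Ghost

variable (m : ℕ) {a : ℝ} (p : ℕ) [NeZero p] {r : Fin 4 → ℕ}

/-- [folklore] **TB5-2c-A′: THE GHOST TERM OF ROUTE T UNDER (R2) FOR ARBITRARY WORDS.**  At `N := N̂`, `Ŵ₀ = D̂ₛN̂`, `T₀ = N̂ᵀL̂D̂ₛᵀ`, `A₀ = 2•G₀⁻¹`,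
`G₀ = N̂ᵀL̂L̂N̂`, for ANY site × bond words `Mₛ Mₜ Mₛₜ` and site words `Yₛ Yₜ Yₛₜ`, with the co-frame jets `T• := (N̂ᵀM•).submatrix id e₁`, the Gram
words `G• := N̂ᵀY•N̂` and the inverse-jet words `A•` of §1:
`hessT ((Ŵ₀ᵀ(T₀ᵀA₀T₀)Ŵ₀)⁻¹; Ŵ₀ᵀ·gram₁ T₀ Tₛ A₀ Aₛ·Ŵ₀, Ŵ₀ᵀ·gram₁ T₀ Tₜ A₀ Aₜ·Ŵ₀, Ŵ₀ᵀ·gramMix T₀ Tₛ Tₜ Tₛₜ A₀ Aₛ Aₜ Aₛₜ·Ŵ₀)`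
`= 2·hessT (Ĉ; MₛD̂, MₜD̂, MₛₜD̂) − hessT (Ĉ; Yₛ, Yₜ, Yₛₜ)`, `Ĉ = N̂G₀⁻¹N̂ᵀ` (`0 < a`, `r ∈ box 4 (m+1)`). -/
theorem hessT_ghostTerm_words (ha : 0 < a) (hr : r ∈ box 4 (m + 1))
    (Mₛ Mₜ Mₛₜ : Matrix (Site 4 ((m + 1) * p)) (Site 4 ((m + 1) * p) × Fin 4) ℝ)
    (Yₛ Yₜ Yₛₜ : Matrix (Site 4 ((m + 1) * p)) (Site 4 ((m + 1) * p)) ℝ) :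
    hessT ((What0 r (m + 1) p)ᵀ
            * (((Nhat r (m + 1) p)ᵀ * Lhat ((m + 1) * p) * (DhatS m p)ᵀ)ᵀ
                * ((2 : ℝ) • ((Nhat r (m + 1) p)ᵀ * Lhat ((m + 1) * p) * Lhat ((m + 1) * p) * Nhat r (m + 1) p)⁻¹)
                * ((Nhat r (m + 1) p)ᵀ * Lhat ((m + 1) * p) * (DhatS m p)ᵀ))
            * What0 r (m + 1) p)⁻¹
          ((What0 r (m + 1) p)ᵀ
            * gram₁ ((Nhat r (m + 1) p)ᵀ * Lhat ((m + 1) * p) * (DhatS m p)ᵀ)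
                (((Nhat r (m + 1) p)ᵀ * Mₛ).submatrix id (e₁ (m + 1) p))
                ((2 : ℝ) • ((Nhat r (m + 1) p)ᵀ * Lhat ((m + 1) * p) * Lhat ((m + 1) * p) * Nhat r (m + 1) p)⁻¹)
                (-((2 : ℝ) • (((Nhat r (m + 1) p)ᵀ * Lhat ((m + 1) * p) * Lhat ((m + 1) * p) * Nhat r (m + 1) p)⁻¹
                    * ((Nhat r (m + 1) p)ᵀ * Yₛ * Nhat r (m + 1) p)
                    * ((Nhat r (m + 1) p)ᵀ * Lhat ((m + 1) * p) * Lhat ((m + 1) * p) * Nhat r (m + 1) p)⁻¹)))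
            * What0 r (m + 1) p)
          ((What0 r (m + 1) p)ᵀ
            * gram₁ ((Nhat r (m + 1) p)ᵀ * Lhat ((m + 1) * p) * (DhatS m p)ᵀ)
                (((Nhat r (m + 1) p)ᵀ * Mₜ).submatrix id (e₁ (m + 1) p))
                ((2 : ℝ) • ((Nhat r (m + 1) p)ᵀ * Lhat ((m + 1) * p) * Lhat ((m + 1) * p) * Nhat r (m + 1) p)⁻¹)
                (-((2 : ℝ) • (((Nhat r (m + 1) p)ᵀ * Lhat ((m + 1) * p) * Lhat ((m + 1) * p) * Nhat r (m + 1) p)⁻¹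
                    * ((Nhat r (m + 1) p)ᵀ * Yₜ * Nhat r (m + 1) p)
                    * ((Nhat r (m + 1) p)ᵀ * Lhat ((m + 1) * p) * Lhat ((m + 1) * p) * Nhat r (m + 1) p)⁻¹)))
            * What0 r (m + 1) p)
          ((What0 r (m + 1) p)ᵀ
            * gramMix ((Nhat r (m + 1) p)ᵀ * Lhat ((m + 1) * p) * (DhatS m p)ᵀ)
                (((Nhat r (m + 1) p)ᵀ * Mₛ).submatrix id (e₁ (m + 1) p))
                (((Nhat r (m + 1) p)ᵀ * Mₜ).submatrix id (e₁ (m + 1) p))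
                (((Nhat r (m + 1) p)ᵀ * Mₛₜ).submatrix id (e₁ (m + 1) p))
                ((2 : ℝ) • ((Nhat r (m + 1) p)ᵀ * Lhat ((m + 1) * p) * Lhat ((m + 1) * p) * Nhat r (m + 1) p)⁻¹)
                (-((2 : ℝ) • (((Nhat r (m + 1) p)ᵀ * Lhat ((m + 1) * p) * Lhat ((m + 1) * p) * Nhat r (m + 1) p)⁻¹
                    * ((Nhat r (m + 1) p)ᵀ * Yₛ * Nhat r (m + 1) p)
                    * ((Nhat r (m + 1) p)ᵀ * Lhat ((m + 1) * p) * Lhat ((m + 1) * p) * Nhat r (m + 1) p)⁻¹)))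
                (-((2 : ℝ) • (((Nhat r (m + 1) p)ᵀ * Lhat ((m + 1) * p) * Lhat ((m + 1) * p) * Nhat r (m + 1) p)⁻¹
                    * ((Nhat r (m + 1) p)ᵀ * Yₜ * Nhat r (m + 1) p)
                    * ((Nhat r (m + 1) p)ᵀ * Lhat ((m + 1) * p) * Lhat ((m + 1) * p) * Nhat r (m + 1) p)⁻¹)))
                ((2 : ℝ) • (-(((Nhat r (m + 1) p)ᵀ * Lhat ((m + 1) * p) * Lhat ((m + 1) * p) * Nhat r (m + 1) p)⁻¹
                      * ((Nhat r (m + 1) p)ᵀ * Yₛₜ * Nhat r (m + 1) p)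
                      * ((Nhat r (m + 1) p)ᵀ * Lhat ((m + 1) * p) * Lhat ((m + 1) * p) * Nhat r (m + 1) p)⁻¹)
                    + ((Nhat r (m + 1) p)ᵀ * Lhat ((m + 1) * p) * Lhat ((m + 1) * p) * Nhat r (m + 1) p)⁻¹
                      * ((Nhat r (m + 1) p)ᵀ * Yₛ * Nhat r (m + 1) p)
                      * ((Nhat r (m + 1) p)ᵀ * Lhat ((m + 1) * p) * Lhat ((m + 1) * p) * Nhat r (m + 1) p)⁻¹
                      * ((Nhat r (m + 1) p)ᵀ * Yₜ * Nhat r (m + 1) p)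
                      * ((Nhat r (m + 1) p)ᵀ * Lhat ((m + 1) * p) * Lhat ((m + 1) * p) * Nhat r (m + 1) p)⁻¹
                    + ((Nhat r (m + 1) p)ᵀ * Lhat ((m + 1) * p) * Lhat ((m + 1) * p) * Nhat r (m + 1) p)⁻¹
                      * ((Nhat r (m + 1) p)ᵀ * Yₜ * Nhat r (m + 1) p)
                      * ((Nhat r (m + 1) p)ᵀ * Lhat ((m + 1) * p) * Lhat ((m + 1) * p) * Nhat r (m + 1) p)⁻¹
                      * ((Nhat r (m + 1) p)ᵀ * Yₛ * Nhat r (m + 1) p)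
                      * ((Nhat r (m + 1) p)ᵀ * Lhat ((m + 1) * p) * Lhat ((m + 1) * p) * Nhat r (m + 1) p)⁻¹))
            * What0 r (m + 1) p)
      = 2 * hessT (Nhat r (m + 1) p * ((Nhat r (m + 1) p)ᵀ * Lhat ((m + 1) * p) * Lhat ((m + 1) * p) * Nhat r (m + 1) p)⁻¹
              * (Nhat r (m + 1) p)ᵀ)
            (Mₛ * Dhat 4 ((m + 1) * p)) (Mₜ * Dhat 4 ((m + 1) * p)) (Mₛₜ * Dhat 4 ((m + 1) * p))
        - hessT (Nhat r (m + 1) p * ((Nhat r (m + 1) p)ᵀ * Lhat ((m + 1) * p) * Lhat ((m + 1) * p) * Nhat r (m + 1) p)⁻¹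
              * (Nhat r (m + 1) p)ᵀ) Yₛ Yₜ Yₛₜ := by
  -- abbreviations (no `set` on terms occurring in binder types)
  set N := Nhat r (m + 1) p with hNdef
  set L := Lhat ((m + 1) * p) with hL
  set W₀ := What0 r (m + 1) p with hW₀
  set T₀ : Matrix (CombRows (toSite r) (m + 1) p) (I 3 (m + 1) p) ℝ := Nᵀ * L * (DhatS m p)ᵀ with hT₀
  set G₀ : Matrix (CombRows (toSite r) (m + 1) p) (CombRows (toSite r) (m + 1) p) ℝ := Nᵀ * L * L * N with hG₀
  set A₀ : Matrix (CombRows (toSite r) (m + 1) p) (CombRows (toSite r) (m + 1) p) ℝ := (2 : ℝ) • G₀⁻¹ with hA₀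
  set Gₛ : Matrix (CombRows (toSite r) (m + 1) p) (CombRows (toSite r) (m + 1) p) ℝ := Nᵀ * Yₛ * N with hGₛ
  set Gₜ : Matrix (CombRows (toSite r) (m + 1) p) (CombRows (toSite r) (m + 1) p) ℝ := Nᵀ * Yₜ * N with hGₜ
  set Gₛₜ : Matrix (CombRows (toSite r) (m + 1) p) (CombRows (toSite r) (m + 1) p) ℝ := Nᵀ * Yₛₜ * N with hGₛₜ
  -- the basis facts of `N̂` and the determinant letters
  have hN := Nhat_range r m p hr
  have hNinj := Nhat_injective r (m + 1) p hr
  have hW : W₀ = DhatS m p * N := What0_eq_DhatS_mul_Nhat r m p hr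
  have hT : (T₀ * W₀).det ≠ 0 := by
    rw [hW]; exact det_coframe_mul_basis_road_ne_zero m p ha hN hNinj
  have hA : A₀.det ≠ 0 := det_weightA_road_ne_zero m p ha hN hNinj
  have hGu : IsUnit G₀.det := by
    have h := isUnit_det_Gjet₀ m p ha hN hNinj
    rw [Gjet₀] at h
    exact h
  -- `hessT_gram_split_jets` with all `W`-jets zero
  have h := hessT_gram_split_jets T₀ ((Nᵀ * Mₛ).submatrix id (e₁ (m + 1) p)) ((Nᵀ * Mₜ).submatrix id (e₁ (m + 1) p)) 0 0
    ((Nᵀ * Mₛₜ).submatrix id (e₁ (m + 1) p))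
    A₀ (-((2 : ℝ) • (G₀⁻¹ * Gₛ * G₀⁻¹))) (-((2 : ℝ) • (G₀⁻¹ * Gₜ * G₀⁻¹))) 0 0
    ((2 : ℝ) • (-(G₀⁻¹ * Gₛₜ * G₀⁻¹) + G₀⁻¹ * Gₛ * G₀⁻¹ * Gₜ * G₀⁻¹ + G₀⁻¹ * Gₜ * G₀⁻¹ * Gₛ * G₀⁻¹))
    W₀ 0 0 0 0 0 hT hA
  rw [gram₁_zero_basis, gram₁_zero_basis, gramMix_zero_basis, gram₀_eq, gram₀_eq] at h
  simp only [Matrix.mul_zero, add_zero] at h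
  rw [h, hessT_inv_words' G₀ Gₛ Gₜ Gₛₜ hGu]
  -- the `X`-words
  have hX₀ : T₀ * W₀ = Nᵀ * (L * L) * N := by
    rw [hT₀, ← Tjet₀_eq_coframe m p N, hW, Tjet₀, Tjet_mul_basis, Mjet₀_mul_Dhat]
  have hXs : (Nᵀ * Mₛ).submatrix id (e₁ (m + 1) p) * W₀ = Nᵀ * (Mₛ * Dhat 4 ((m + 1) * p)) * N := by rw [hW, Tjet_mul_basis]
  have hXt : (Nᵀ * Mₜ).submatrix id (e₁ (m + 1) p) * W₀ = Nᵀ * (Mₜ * Dhat 4 ((m + 1) * p)) * N := by rw [hW, Tjet_mul_basis]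
  have hXst : (Nᵀ * Mₛₜ).submatrix id (e₁ (m + 1) p) * W₀ = Nᵀ * (Mₛₜ * Dhat 4 ((m + 1) * p)) * N := by rw [hW, Tjet_mul_basis]
  rw [hX₀, hXs, hXt, hXst, hessT_compress, hGₛ, hGₜ, hGₛₜ, hessT_compress]
  have hG₀' : Nᵀ * (L * L) * N = G₀ := by rw [hG₀]; simp only [Matrix.mul_assoc]
  rw [hG₀']
  ring

end Ghost

/-! ## §3 TB5-1 for arbitrary words -/

section Transfer

variable (m : ℕ) {a : ℝ} (p : ℕ) [NeZero p] {r : Fin 4 → ℕ}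

/-- [folklore] **THE PER-TORUS IDENTITY OF ROUTE T UNDER (R2) FOR ARBITRARY WORDS**: TB5-1 `hessT_transfer_road_Nhat` at the co-frame ∕ inverse-jet words
of ANY `Mₛ Mₜ Mₛₜ` (site × bond) and `Yₛ Yₜ Yₛₜ` (site × site), with its ghost term rewritten by `hessT_ghostTerm_words`:
`hessT (M_T⁻¹|_{ν⊕μ}; kkt K• Q•) + (2·hessT (Ĉ; M•D̂) − hessT (Ĉ; Y•)) = hessT (blocksHat p (sortK (m+1) (NlegRoad m a)); kkt (K• + B•) Q•)`,
`B• = gram• (T̂₀, (N̂ᵀM•).submatrix id e₁; Â₀, A•-words)`.  Displayed: the table jets + kinematic Ward letters, `Spr (Ga (m+1) a)`. -/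
theorem hessT_transfer_road_words (ha : 0 < a) (hGa : Spr (GluonLeg.Ga (m + 1) a)) (hr : r ∈ box 4 (m + 1))
    (Mₛ Mₜ Mₛₜ : Matrix (Site 4 ((m + 1) * p)) (Site 4 ((m + 1) * p) × Fin 4) ℝ)
    (Yₛ Yₜ Yₛₜ : Matrix (Site 4 ((m + 1) * p)) (Site 4 ((m + 1) * p)) ℝ)
    (Kₛ Kₜ Kₛₜ : Matrix (I 3 (m + 1) p) (I 3 (m + 1) p) ℝ) (Qₛ Qₜ Qₛₜ : Matrix (J 3 p) (I 3 (m + 1) p) ℝ)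
    (kₛ : Kₛ * What0 r (m + 1) p = 0) (kₛt : Kₛᵀ * What0 r (m + 1) p = 0)
    (kₜ : Kₜ * What0 r (m + 1) p = 0) (kₜt : Kₜᵀ * What0 r (m + 1) p = 0)
    (kₛₜ : Kₛₜ * What0 r (m + 1) p = 0) (kₛₜt : Kₛₜᵀ * What0 r (m + 1) p = 0)
    (qₛ : Qₛ * What0 r (m + 1) p = 0) (qₜ : Qₜ * What0 r (m + 1) p = 0) (qₛₜ : Qₛₜ * What0 r (m + 1) p = 0) :
    let N := Nhat r (m + 1) p
    let L := Lhat ((m + 1) * p)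
    let T₀ : Matrix (CombRows (toSite r) (m + 1) p) (I 3 (m + 1) p) ℝ := Nᵀ * L * (DhatS m p)ᵀ
    let G₀ : Matrix (CombRows (toSite r) (m + 1) p) (CombRows (toSite r) (m + 1) p) ℝ := Nᵀ * L * L * N
    let A₀ : Matrix (CombRows (toSite r) (m + 1) p) (CombRows (toSite r) (m + 1) p) ℝ := (2 : ℝ) • G₀⁻¹
    let Tₛ : Matrix (CombRows (toSite r) (m + 1) p) (I 3 (m + 1) p) ℝ := (Nᵀ * Mₛ).submatrix id (e₁ (m + 1) p)
    let Tₜ : Matrix (CombRows (toSite r) (m + 1) p) (I 3 (m + 1) p) ℝ := (Nᵀ * Mₜ).submatrix id (e₁ (m + 1) p)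
    let Tₛₜ : Matrix (CombRows (toSite r) (m + 1) p) (I 3 (m + 1) p) ℝ := (Nᵀ * Mₛₜ).submatrix id (e₁ (m + 1) p)
    let Aₛ : Matrix (CombRows (toSite r) (m + 1) p) (CombRows (toSite r) (m + 1) p) ℝ := -((2 : ℝ) • (G₀⁻¹ * (Nᵀ * Yₛ * N) * G₀⁻¹))
    let Aₜ : Matrix (CombRows (toSite r) (m + 1) p) (CombRows (toSite r) (m + 1) p) ℝ := -((2 : ℝ) • (G₀⁻¹ * (Nᵀ * Yₜ * N) * G₀⁻¹))
    let Aₛₜ : Matrix (CombRows (toSite r) (m + 1) p) (CombRows (toSite r) (m + 1) p) ℝ :=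
      (2 : ℝ) • (-(G₀⁻¹ * (Nᵀ * Yₛₜ * N) * G₀⁻¹) + G₀⁻¹ * (Nᵀ * Yₛ * N) * G₀⁻¹ * (Nᵀ * Yₜ * N) * G₀⁻¹
        + G₀⁻¹ * (Nᵀ * Yₜ * N) * G₀⁻¹ * (Nᵀ * Yₛ * N) * G₀⁻¹)
    hessT ((kkt (Khat (d := 3) (m + 1) p) (Matrix.fromRows (Qhat (d := 3) (m + 1) p) (tauT (toSite r) (m + 1) p)))⁻¹.submatrix
          (Sum.map id Sum.inl) (Sum.map id Sum.inl)) (kkt Kₛ Qₛ) (kkt Kₜ Qₜ) (kkt Kₛₜ Qₛₜ)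
      + (2 * hessT (N * G₀⁻¹ * Nᵀ) (Mₛ * Dhat 4 ((m + 1) * p)) (Mₜ * Dhat 4 ((m + 1) * p)) (Mₛₜ * Dhat 4 ((m + 1) * p))
          - hessT (N * G₀⁻¹ * Nᵀ) Yₛ Yₜ Yₛₜ)
    = hessT (blocksHat p (sortK (m + 1) (NlegRoad m a)))
        (kkt (Kₛ + gram₁ T₀ Tₛ A₀ Aₛ) Qₛ) (kkt (Kₜ + gram₁ T₀ Tₜ A₀ Aₜ) Qₜ) (kkt (Kₛₜ + gramMix T₀ Tₛ Tₜ Tₛₜ A₀ Aₛ Aₜ Aₛₜ) Qₛₜ) := by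
  intro N L T₀ G₀ A₀ Tₛ Tₜ Tₛₜ Aₛ Aₜ Aₛₜ
  have h := hessT_transfer_road_Nhat m p ha hGa hr Kₛ Kₜ Kₛₜ Qₛ Qₜ Qₛₜ Tₛ Tₜ Tₛₜ Aₛ Aₜ Aₛₜ kₛ kₛt kₜ kₜt kₛₜ kₛₜt qₛ qₜ qₛₜ
  rw [hessT_ghostTerm_words m p ha hr Mₛ Mₜ Mₛₜ Yₛ Yₜ Yₛₜ] at h
  exact h

end Transfer

end Summit.QuantumFields.BalabanUV.Beta.D1BFx.KGhostTermWords

end
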